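import Mathlib
import Literature.Analysis.ODE.LinearComparison
import Literature.Barriers.NavierStokesRegularity.DyadicCascadeRegularity
import HarnessLib

/-!
# The viscous dyadic model: positivity and the energy inequality for weak solutions
  (Barbato–Morandin–Romito 2011, §3; Cheskidov 2008, Thm. 4.2)

Barrier catalogue `Literature/Barriers/NavierStokesRegularity/`, first **proof file** towards the
named fact `Dyadic.BarbatoMorandinRomito2011_thm1` (`DyadicCascadeRegularity`). For the viscous
dyadic model (BMR (1.1)) `Ẋₙ = -νλₙ²Xₙ + λ_{n-1}^βX_{n-1}² - λₙ^βXₙX_{n+1}`, `λ₀ = 0`, `λₙ = 2ⁿ`,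
and its weak solutions in the sense of BMR Def. 3.1 (`IsBMRWeakSolution`: `C¹` modes on `[0,∞)`
solving the system, no summability built in) we prove the two facts that BMR §3 quote from
Cheskidov 2008 (Thm. 4.2 there, for Cheskidov's normalisation of the same system):

* **positivity** (`IsBMRWeakSolution.nonneg`): if `xₙ ≥ 0` for all `n ≥ 1` then every weak
  solution has `Xₙ(t) ≥ 0` for `n ≥ 1`, `t ≥ 0` — Cheskidov's proof: mode `n` solves the *linear*
  equation `Ẋₙ = Aₙ(t) + Bₙ(t)Xₙ` with `Aₙ = λ_{n-1}^βX_{n-1}² ≥ 0`, so the variation-of-constants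
  formula (here `Literature.Analysis.ODE.linearComparison_le`) gives `Xₙ ≥ 0` whatever the sign of
  `Bₙ = -νλₙ² - λₙ^βX_{n+1}`;
* **the energy inequality from every time** (`IsBMRWeakSolution.energy_le`): for such solutions and
  every `N`, `∑_{n≤N} Xₙ(t)² + 2ν∫ₛᵗ ∑_{n≤N} λₙ²Xₙ² ≤ ∑_{n≤N} Xₙ(s)²` (`0 ≤ s ≤ t`) — the truncated
  energy has derivative `-2ν∑_{n≤N}λₙ²Xₙ² - 2λ_N^βX_N²X_{N+1} ≤ -2ν∑λₙ²Xₙ²` because the flux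
  telescopes (`λ₀ = 0`) and `X_{N+1} ≥ 0` ("there is no backward energy transfer");

and their consequences for square-summable data: `X(t) ∈ ℓ²` with `∑_{n≥1} Xₙ(t)² ≤ ∑ xₙ²`
(`sum_sq_le_tsum`, `summable_sq`, `le_sqrt_tsum`), summability of the dissipation
`∑ₙ ∫₀ᵗ λₙ²Xₙ² ≤ ∑xₙ²/(2ν)` (`summable_integral_dissipation`) and hence
`∫₀ᵗ λ_N²X_N² → 0` (`tendsto_integral_dissipation`), the input of BMR's uniqueness proof
(Prop. 3.2). Also: index bookkeeping for `bmrRHS`, continuity of the modes, and the invariance of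
the solution notion under time shifts (`IsBMRWeakSolution.shift`). Theorem-only module.

## References

* D. Barbato, F. Morandin, M. Romito, *Smooth solutions for the dyadic model*, Nonlinearity 24
  (2011) 3083–3097, §1.1 (1.1), §3 Def. 3.1 and the list of facts after it. [`BarbatoMorandinRomito2011`]
* A. Cheskidov, *Blow-up in finite time for the dyadic model of the Navier–Stokes equations*,
  Trans. AMS 360 (2008) 5101–5120, §4 Thm. 4.2 and its proof. [`Cheskidov2008`]
-/

noncomputable section

open Set Filter MeasureTheory intervalIntegral
open scoped Topology BigOperators

namespace Literature.Barriers.NavierStokesRegularity.Dyadic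

/-! ## Wave numbers -/

/-- `λ_{m+1} = 2^{m+1}`. [cite: BarbatoMorandinRomito2011, §1.1 (1.1)] -/
theorem bmrLambda_succ (m : ℕ) : bmrLambda (m + 1) = 2 ^ (m + 1) :=
  bmrLambda_of_ne_zero (Nat.succ_ne_zero m)

/-- `λₙ > 0` for `n ≥ 1`. [cite: BarbatoMorandinRomito2011, §1.1 (1.1)] -/
theorem bmrLambda_pos {n : ℕ} (hn : n ≠ 0) : 0 < bmrLambda n := by
  rw [bmrLambda_of_ne_zero hn]; positivity

/-- `λₙ ≥ 1` for `n ≥ 1`. [cite: BarbatoMorandinRomito2011, §1.1 (1.1)] -/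
theorem one_le_bmrLambda {n : ℕ} (hn : n ≠ 0) : 1 ≤ bmrLambda n := by
  rw [bmrLambda_of_ne_zero hn]; exact one_le_pow₀ (by norm_num)

/-- `λ_{m+2} = 2 λ_{m+1}` (`λ = 2`). [cite: BarbatoMorandinRomito2011, §1.1 (1.1)] -/
theorem bmrLambda_succ_succ (m : ℕ) : bmrLambda (m + 2) = 2 * bmrLambda (m + 1) := by
  rw [bmrLambda_succ, bmrLambda_succ, pow_succ]; ring

/-- `λ₀^β = 0` for `β ≠ 0`: the forcing of the first mode from below vanishes. [folklore] -/
theorem bmrLambda_zero_rpow {β : ℝ} (hβ : β ≠ 0) : bmrLambda 0 ^ β = 0 := by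
  rw [bmrLambda_zero, Real.zero_rpow hβ]

/-- The coupling coefficients `λₙ^β` are non-negative. [folklore] -/
theorem bmrLambda_rpow_nonneg (n : ℕ) (β : ℝ) : 0 ≤ bmrLambda n ^ β :=
  Real.rpow_nonneg (bmrLambda_nonneg n) β

/-! ## The right-hand side -/

/-- The right-hand side of (1.1) at mode `m + 1`, with the index arithmetic resolved:
`-νλ_{m+1}²X_{m+1} + λ_m^βX_m² - λ_{m+1}^βX_{m+1}X_{m+2}`. [cite: BarbatoMorandinRomito2011, §1.1 (1.1)] -/
theorem bmrRHS_succ (ν β : ℝ) (X : ℕ → ℝ) (m : ℕ) :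
    bmrRHS ν β X (m + 1) =
      -ν * bmrLambda (m + 1) ^ 2 * X (m + 1) + bmrLambda m ^ β * X m ^ 2 -
        bmrLambda (m + 1) ^ β * X (m + 1) * X (m + 2) := by
  simp only [bmrRHS, Nat.add_sub_cancel]

/-- The right-hand side at mode `m + 1` in the *linear* form used for positivity:
`RHS_{m+1} = λ_m^βX_m² + (-νλ_{m+1}² - λ_{m+1}^βX_{m+2})·X_{m+1}`. [cite: Cheskidov2008, §4 Thm. 4.2 (proof)] -/
theorem bmrRHS_succ_eq_linear (ν β : ℝ) (X : ℕ → ℝ) (m : ℕ) :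
    bmrRHS ν β X (m + 1) =
      bmrLambda m ^ β * X m ^ 2 +
        (-ν * bmrLambda (m + 1) ^ 2 - bmrLambda (m + 1) ^ β * X (m + 2)) * X (m + 1) := by
  rw [bmrRHS_succ]; ring

/-- The right-hand side at mode `m + 1` depends only on the modes `m, m + 1, m + 2`, and not on
mode `0` (for `β ≠ 0`): two states agreeing at all modes `≥ 1` have the same right-hand sides at
all modes `≥ 1`. [folklore] -/
theorem bmrRHS_succ_congr (ν : ℝ) {β : ℝ} (hβ : β ≠ 0) {X Y : ℕ → ℝ}
    (h : ∀ n, 1 ≤ n → X n = Y n) (m : ℕ) : bmrRHS ν β X (m + 1) = bmrRHS ν β Y (m + 1) := by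
  rcases m with _ | m
  · rw [bmrRHS_one hβ, bmrRHS_one hβ, h 1 le_rfl, h 2 (by norm_num)]
  · rw [bmrRHS_succ, bmrRHS_succ, h (m + 1) (by omega), h (m + 1 + 1) (by omega),
      h (m + 1 + 2) (by omega)]

/-! ## Weak solutions: continuity, time shifts -/

section WeakSolution

variable {ν β : ℝ} {x : ℕ → ℝ} {X : ℕ → ℝ → ℝ}

/-- The modes `n ≥ 1` of a weak solution are continuous on `[0, ∞)`. [cite: BarbatoMorandinRomito2011, §3 Def. 3.1] -/
theorem IsBMRWeakSolution.continuousOn (hX : IsBMRWeakSolution ν β x X) {n : ℕ} (hn : 1 ≤ n) :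
    ContinuousOn (X n) (Ici 0) := fun t ht => (hX.2 n hn t ht).continuousWithinAt

/-- The clamped modes `t ↦ Xₙ(max t 0)` (`n ≥ 1`) of a weak solution are continuous on `ℝ`. [folklore] -/
theorem IsBMRWeakSolution.continuous_clamp (hX : IsBMRWeakSolution ν β x X) {n : ℕ} (hn : 1 ≤ n) :
    Continuous fun t => X n (max t 0) :=
  (hX.continuousOn hn).comp_continuous (continuous_id.max continuous_const) fun t => le_max_right t 0

/-- The right-hand side at a mode `m + 1` is continuous on `[0, ∞)` along a weak solution
(`β ≠ 0`, so that the unconstrained mode `0` does not enter). [folklore] -/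
theorem IsBMRWeakSolution.continuousOn_rhs (hX : IsBMRWeakSolution ν β x X) (hβ : β ≠ 0) (m : ℕ) :
    ContinuousOn (fun t => bmrRHS ν β (fun k => X k t) (m + 1)) (Ici 0) := by
  rcases m with _ | m
  · simp only [bmrRHS_one hβ]
    exact ((continuousOn_const.mul (hX.continuousOn le_rfl)).sub
      ((continuousOn_const.mul (hX.continuousOn le_rfl)).mul (hX.continuousOn (by norm_num))))
  · simp only [bmrRHS_succ]
    exact ((continuousOn_const.mul (hX.continuousOn (by omega))).add
      (continuousOn_const.mul ((hX.continuousOn (by omega)).pow 2))).sub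
      ((continuousOn_const.mul (hX.continuousOn (by omega))).mul (hX.continuousOn (by omega)))

/-- **Time shifts.** If `X` is a weak solution with datum `x`, then for `s ≥ 0` the shifted
family `t ↦ Xₙ(t + s)` is a weak solution with datum `X(s)` (the system is autonomous). [folklore] -/
theorem IsBMRWeakSolution.shift (hX : IsBMRWeakSolution ν β x X) {s : ℝ} (hs : 0 ≤ s) :
    IsBMRWeakSolution ν β (fun n => X n s) (fun n t => X n (t + s)) := by
  refine ⟨fun n _ => by simp, fun n hn t ht => ?_⟩
  have h := hX.2 n hn (t + s) (by positivity)
  have hid : HasDerivWithinAt (fun τ : ℝ => τ + s) 1 (Ici 0) t := (hasDerivWithinAt_id t _).add_const s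
  have hmaps : MapsTo (fun τ : ℝ => τ + s) (Ici 0) (Ici 0) := fun τ (hτ : 0 ≤ τ) =>
    show (0 : ℝ) ≤ τ + s by positivity
  have := HasDerivWithinAt.comp (𝕜 := ℝ) t h hid hmaps
  simpa [Function.comp_def] using this

/-- Restating the datum: a weak solution with datum `x` is a weak solution with datum `X(0)`,
and conversely the datum can be replaced by any sequence agreeing with it at modes `≥ 1`. [folklore] -/
theorem IsBMRWeakSolution.congr_datum (hX : IsBMRWeakSolution ν β x X) {y : ℕ → ℝ}
    (h : ∀ n, 1 ≤ n → y n = x n) : IsBMRWeakSolution ν β y X :=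
  ⟨fun n hn => (hX.1 n hn).trans (h n hn).symm, hX.2⟩

end WeakSolution

/-! ## Positivity (Cheskidov 2008, Thm. 4.2, first part) -/

section Positivity

variable {ν β : ℝ} {X : ℕ → ℝ → ℝ} {N : ℕ}

/-- **Positivity, local form.** Suppose the modes `1, …, N` of `X : ℕ → ℝ → ℝ` solve (1.1) on
`[0, ∞)` (one-sided derivatives within `[0, ∞)`), the mode `N + 1` is continuous there, `β ≠ 0`,
and `Xₙ(0) ≥ 0` for `1 ≤ n ≤ N`. Then `Xₙ(t) ≥ 0` for `1 ≤ n ≤ N`, `t ≥ 0`. This covers at once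
weak solutions of the full system and the finite truncations used later. Proof (Cheskidov 2008,
proof of Thm. 4.2): mode `n` solves the linear equation
`Ẋₙ = λ_{n-1}^βX_{n-1}² + (-νλₙ² - λₙ^βX_{n+1})Xₙ` with non-negative source, whence
`Xₙ(t) ≥ e^{∫B}(Xₙ(0) + ∫ A e^{-∫B}) ≥ 0` (`linearComparison_le`); no sign of `ν` is needed.
[cite: Cheskidov2008, §4 Thm. 4.2] -/
theorem nonneg_of_modes (hβ : β ≠ 0)
    (hd : ∀ m < N, ∀ t, 0 ≤ t →
      HasDerivWithinAt (X (m + 1)) (bmrRHS ν β (fun k => X k t) (m + 1)) (Ici 0) t)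
    (hc : ContinuousOn (X (N + 1)) (Ici 0)) (h0 : ∀ m < N, 0 ≤ X (m + 1) 0) :
    ∀ m < N, ∀ t, 0 ≤ t → 0 ≤ X (m + 1) t := by
  intro m hm t ht
  have hcont : ∀ k, 1 ≤ k → k ≤ N + 1 → ContinuousOn (X k) (Ici 0) := by
    intro k hk1 hk2
    rcases eq_or_lt_of_le hk2 with rfl | hlt
    · exact hc
    · obtain ⟨j, rfl⟩ : ∃ j, k = j + 1 := ⟨k - 1, by omega⟩
      exact fun τ hτ => (hd j (by omega) τ hτ).continuousWithinAt
  -- the linear structure of mode `m + 1`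
  set A : ℝ → ℝ := fun τ => bmrLambda m ^ β * X m τ ^ 2 with hA
  set B : ℝ → ℝ := fun τ => -ν * bmrLambda (m + 1) ^ 2 - bmrLambda (m + 1) ^ β * X (m + 2) τ
    with hB
  have hAc : ContinuousOn A (Icc 0 t) := by
    rcases m with _ | m
    · have : A = fun _ => 0 := by funext τ; simp [hA, Real.zero_rpow hβ]
      rw [this]; exact continuousOn_const
    · exact (continuousOn_const.mul ((hcont (m + 1) (by omega) (by omega)).pow 2)).mono
        Icc_subset_Ici_self
  have hBc : ContinuousOn B (Icc 0 t) :=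
    (continuousOn_const.sub (continuousOn_const.mul (hcont (m + 2) (by omega) (by omega)))).mono
      Icc_subset_Ici_self
  have hA0 : ∀ τ, 0 ≤ A τ := fun τ => mul_nonneg (bmrLambda_rpow_nonneg m β) (sq_nonneg _)
  have hg : ContinuousOn (X (m + 1)) (Icc 0 t) :=
    (hcont (m + 1) (by omega) (by omega)).mono Icc_subset_Ici_self
  have hg' : ∀ τ ∈ Ico 0 t, HasDerivWithinAt (X (m + 1)) (A τ + B τ * X (m + 1) τ) (Ici τ) τ := by
    intro τ hτ
    have h := (hd m hm τ hτ.1).mono (Ici_subset_Ici.2 hτ.1)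
    rw [bmrRHS_succ_eq_linear] at h
    exact h
  have key := Literature.Analysis.ODE.linearComparison_le hg hg' hAc hBc
    (fun τ _ => le_rfl) (right_mem_Icc.2 ht)
  refine le_trans (mul_nonneg (Real.exp_pos _).le (add_nonneg (h0 m hm) ?_)) key
  exact intervalIntegral.integral_nonneg ht fun τ _ => mul_nonneg (hA0 τ) (Real.exp_pos _).le

variable {x : ℕ → ℝ}

/-- **Positivity of weak solutions** (Cheskidov 2008, Thm. 4.2: "Let `u(t)` be a solution … with
`uₙ(0) ≥ 0`. Then `uₙ(t) ≥ 0` for all `t > 0`"; quoted in BMR §3: for positive data "every weak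
solution … stays positive for all times"). For `β ≠ 0` and a datum with `xₙ ≥ 0` (`n ≥ 1`), every
weak solution of (1.1) satisfies `Xₙ(t) ≥ 0` for all `n ≥ 1`, `t ≥ 0`.
[cite: Cheskidov2008, §4 Thm. 4.2] [cite: BarbatoMorandinRomito2011, §3] -/
theorem IsBMRWeakSolution.nonneg (hX : IsBMRWeakSolution ν β x X) (hβ : β ≠ 0)
    (hx : ∀ n, 1 ≤ n → 0 ≤ x n) : ∀ n, 1 ≤ n → ∀ t, 0 ≤ t → 0 ≤ X n t := by
  intro n hn t ht
  obtain ⟨m, rfl⟩ : ∃ m, n = m + 1 := ⟨n - 1, by omega⟩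
  refine nonneg_of_modes (N := m + 1) hβ (fun j _ τ hτ => hX.2 (j + 1) (by omega) τ hτ)
    (hX.continuousOn (by omega)) (fun j _ => ?_) m (Nat.lt_succ_self m) t ht
  rw [hX.1 (j + 1) (by omega)]
  exact hx (j + 1) (by omega)

end Positivity

/-! ## The energy inequality (Cheskidov 2008, Thm. 4.2, second part) -/

section Energy

variable {ν β : ℝ} {X : ℕ → ℝ → ℝ} {N : ℕ}

/-- **The nonlinear flux telescopes**:
`∑_{m<N} (λ_m^βX_m²X_{m+1} - λ_{m+1}^βX_{m+1}²X_{m+2}) = λ₀^βX₀²X₁ - λ_N^βX_N²X_{N+1}`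
(and `λ₀ = 0`): the energy identity of the dyadic model. [cite: Cheskidov2008, §4 Thm. 4.2 (proof)] -/
theorem sum_bmrFlux (β : ℝ) (X : ℕ → ℝ) (N : ℕ) :
    ∑ m ∈ Finset.range N, (bmrLambda m ^ β * X m ^ 2 * X (m + 1) -
        bmrLambda (m + 1) ^ β * X (m + 1) ^ 2 * X (m + 2)) =
      bmrLambda 0 ^ β * X 0 ^ 2 * X 1 - bmrLambda N ^ β * X N ^ 2 * X (N + 1) :=
  Finset.sum_range_sub' (fun m => bmrLambda m ^ β * X m ^ 2 * X (m + 1)) N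

/-- **Energy identity for states**: for `β ≠ 0` and any `X : ℕ → ℝ`,
`2∑_{n=1}^{N} Xₙ·RHSₙ(X) = -2ν∑_{n=1}^{N} λₙ²Xₙ² - 2λ_N^βX_N²X_{N+1}` ("multiplying (1.1) by `Xₙ`,
taking a sum from `1` to `N`"). [cite: Cheskidov2008, §4 Thm. 4.2 (proof)] -/
theorem two_mul_sum_mul_bmrRHS (ν : ℝ) {β : ℝ} (hβ : β ≠ 0) (X : ℕ → ℝ) (N : ℕ) :
    2 * ∑ m ∈ Finset.range N, X (m + 1) * bmrRHS ν β X (m + 1) =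
      -2 * ν * ∑ m ∈ Finset.range N, bmrLambda (m + 1) ^ 2 * X (m + 1) ^ 2 -
        2 * (bmrLambda N ^ β * X N ^ 2 * X (N + 1)) := by
  have h : ∀ m, X (m + 1) * bmrRHS ν β X (m + 1) =
      -ν * (bmrLambda (m + 1) ^ 2 * X (m + 1) ^ 2) +
        (bmrLambda m ^ β * X m ^ 2 * X (m + 1) -
          bmrLambda (m + 1) ^ β * X (m + 1) ^ 2 * X (m + 2)) := by
    intro m; rw [bmrRHS_succ]; ring
  simp only [h, Finset.sum_add_distrib, ← Finset.mul_sum, sum_bmrFlux, bmrLambda_zero_rpow hβ]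
  ring

/-- Derivative of the truncated energy `∑_{n ≤ N} Xₙ(t)²` when the modes `1, …, N` solve (1.1)
within a set `S`. [folklore] -/
theorem hasDerivWithinAt_bmrEnergy {S : Set ℝ} {t : ℝ}
    (hd : ∀ m < N, HasDerivWithinAt (X (m + 1)) (bmrRHS ν β (fun k => X k t) (m + 1)) S t) :
    HasDerivWithinAt (fun τ => ∑ m ∈ Finset.range N, X (m + 1) τ ^ 2)
      (2 * ∑ m ∈ Finset.range N, X (m + 1) t * bmrRHS ν β (fun k => X k t) (m + 1)) S t := by
  rw [Finset.mul_sum]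
  have := HasDerivWithinAt.fun_sum (u := Finset.range N) (A := fun m τ => X (m + 1) τ ^ 2)
    (A' := fun m => 2 * X (m + 1) t * bmrRHS ν β (fun k => X k t) (m + 1)) (x := t) (s := S)
    fun m hm => by simpa using (hd m (Finset.mem_range.1 hm)).fun_pow 2
  simpa [mul_assoc] using this

/-- **Energy inequality, local form** (Cheskidov 2008, Thm. 4.2: "multiplying (3.1) by `uₙ`,
taking a sum from `1` to `N`, and integrating between `t₀` and `t`, we obtain
`∑uₙ(t)² - ∑uₙ(t₀)² + 2ν∫∑λ^{2αn}uₙ² = -2∫λ^{N+1}u_N²u_{N+1} ≤ 0`"). If the modes `1, …, N` of `X`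
solve (1.1) on `[0, ∞)`, the mode `N + 1` is continuous and non-negative there and `β ≠ 0`, then
for `0 ≤ s ≤ t`: `∑_{n≤N} Xₙ(t)² + 2ν∫ₛᵗ∑_{n≤N} λₙ²Xₙ² ≤ ∑_{n≤N} Xₙ(s)²`. No sign assumption on
`ν`. [cite: Cheskidov2008, §4 Thm. 4.2] [cite: BarbatoMorandinRomito2011, §3 Def. 3.1] -/
theorem energy_le_of_modes (hβ : β ≠ 0)
    (hd : ∀ m < N, ∀ t, 0 ≤ t →
      HasDerivWithinAt (X (m + 1)) (bmrRHS ν β (fun k => X k t) (m + 1)) (Ici 0) t)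
    (hc : ContinuousOn (X (N + 1)) (Ici 0)) (hpos : ∀ t, 0 ≤ t → 0 ≤ X (N + 1) t)
    {s t : ℝ} (hs : 0 ≤ s) (hst : s ≤ t) :
    ∑ m ∈ Finset.range N, X (m + 1) t ^ 2 +
        2 * ν * ∫ τ in s..t, ∑ m ∈ Finset.range N, bmrLambda (m + 1) ^ 2 * X (m + 1) τ ^ 2 ≤
      ∑ m ∈ Finset.range N, X (m + 1) s ^ 2 := by
  rcases Nat.eq_zero_or_pos N with rfl | hN
  · simp
  obtain ⟨M, rfl⟩ : ∃ M, N = M + 1 := ⟨N - 1, by omega⟩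
  have hcont : ∀ k, 1 ≤ k → k ≤ M + 2 → ContinuousOn (X k) (Ici 0) := by
    intro k hk1 hk2
    rcases eq_or_lt_of_le hk2 with rfl | hlt
    · exact hc
    · obtain ⟨j, rfl⟩ : ∃ j, k = j + 1 := ⟨k - 1, by omega⟩
      exact fun τ hτ => (hd j (by omega) τ hτ).continuousWithinAt
  -- the players
  set E : ℝ → ℝ := fun τ => ∑ m ∈ Finset.range (M + 1), X (m + 1) τ ^ 2 with hE
  set D : ℝ → ℝ := fun τ => ∑ m ∈ Finset.range (M + 1), bmrLambda (m + 1) ^ 2 * X (m + 1) τ ^ 2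
    with hD
  set F : ℝ → ℝ := fun τ => bmrLambda (M + 1) ^ β * X (M + 1) τ ^ 2 * X (M + 2) τ with hF
  have hEc : ContinuousOn E (Ici 0) :=
    continuousOn_finsetSum _ fun m hm => (hcont (m + 1) (by omega)
      (by have := Finset.mem_range.1 hm; omega)).pow 2
  have hDc : ContinuousOn D (Ici 0) :=
    continuousOn_finsetSum _ fun m hm => continuousOn_const.mul ((hcont (m + 1) (by omega)
      (by have := Finset.mem_range.1 hm; omega)).pow 2)
  have hFc : ContinuousOn F (Ici 0) :=
    (continuousOn_const.mul ((hcont (M + 1) (by omega) (by omega)).pow 2)).mul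
      (hcont (M + 2) (by omega) le_rfl)
  have hderiv : ∀ τ, 0 ≤ τ → HasDerivWithinAt E (-2 * ν * D τ - 2 * F τ) (Ici 0) τ := by
    intro τ hτ
    have h := hasDerivWithinAt_bmrEnergy (fun m hm => hd m hm τ hτ)
    exact h.congr_deriv (two_mul_sum_mul_bmrRHS ν hβ (fun k => X k τ) (M + 1))
  -- integrate
  have hst' : Icc s t ⊆ Ici 0 := fun τ hτ => hs.trans hτ.1
  have hDi : IntervalIntegrable D volume s t := (hDc.mono hst').intervalIntegrable_of_Icc hst
  have hFi : IntervalIntegrable F volume s t := (hFc.mono hst').intervalIntegrable_of_Icc hst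
  have hftc := intervalIntegral.integral_eq_sub_of_hasDeriv_right_of_le hst (hEc.mono hst')
    (fun τ hτ => (hderiv τ (hs.trans hτ.1.le)).mono fun r hr => hs.trans (hτ.1.le.trans hr.le))
    ((hDi.const_mul (-2 * ν)).sub (hFi.const_mul 2))
  rw [intervalIntegral.integral_sub (hDi.const_mul _) (hFi.const_mul _),
    intervalIntegral.integral_const_mul, intervalIntegral.integral_const_mul] at hftc
  have hF0 : 0 ≤ ∫ τ in s..t, F τ :=
    intervalIntegral.integral_nonneg hst fun τ hτ =>
      mul_nonneg (mul_nonneg (bmrLambda_rpow_nonneg _ _) (sq_nonneg _)) (hpos τ (hs.trans hτ.1))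
  show E t + 2 * ν * ∫ τ in s..t, D τ ≤ E s
  linarith

variable {x : ℕ → ℝ}

/-- **Energy inequality for weak solutions with non-negative data, from every time** (BMR §3:
"if the initial condition is positive … every weak solution is a Leray–Hopf solution … and the
energy inequality holds for all times"; Cheskidov 2008, Thm. 4.2), in truncated form: for `β ≠ 0`,
`xₙ ≥ 0`, every `N` and `0 ≤ s ≤ t`, `∑_{n≤N} Xₙ(t)² + 2ν∫ₛᵗ∑_{n≤N}λₙ²Xₙ² ≤ ∑_{n≤N} Xₙ(s)²`.
[cite: Cheskidov2008, §4 Thm. 4.2] [cite: BarbatoMorandinRomito2011, §3] -/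
theorem IsBMRWeakSolution.energy_le (hX : IsBMRWeakSolution ν β x X) (hβ : β ≠ 0)
    (hx : ∀ n, 1 ≤ n → 0 ≤ x n) (N : ℕ) {s t : ℝ} (hs : 0 ≤ s) (hst : s ≤ t) :
    ∑ m ∈ Finset.range N, X (m + 1) t ^ 2 +
        2 * ν * ∫ τ in s..t, ∑ m ∈ Finset.range N, bmrLambda (m + 1) ^ 2 * X (m + 1) τ ^ 2 ≤
      ∑ m ∈ Finset.range N, X (m + 1) s ^ 2 :=
  energy_le_of_modes hβ (fun m _ τ hτ => hX.2 (m + 1) (by omega) τ hτ) (hX.continuousOn (by omega))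
    (fun τ hτ => hX.nonneg hβ hx (N + 1) (by omega) τ hτ) hs hst

/-- The truncated energies of a weak solution with non-negative square-summable datum are bounded
by `∑ xₙ²` (`ν ≥ 0`; the sum over all `n ∈ ℕ` of the datum, whose mode `0` is immaterial, is an
upper bound). [cite: Cheskidov2008, §4 Thm. 4.2] -/
theorem IsBMRWeakSolution.sum_sq_le_tsum (hX : IsBMRWeakSolution ν β x X) (hβ : β ≠ 0)
    (hν : 0 ≤ ν) (hx : ∀ n, 1 ≤ n → 0 ≤ x n) (hx2 : Summable fun n => x n ^ 2) (N : ℕ) {t : ℝ}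
    (ht : 0 ≤ t) : ∑ m ∈ Finset.range N, X (m + 1) t ^ 2 ≤ ∑' n, x n ^ 2 := by
  have h := hX.energy_le hβ hx N le_rfl ht
  have hD : 0 ≤ ∫ τ in (0 : ℝ)..t, ∑ m ∈ Finset.range N, bmrLambda (m + 1) ^ 2 * X (m + 1) τ ^ 2 :=
    intervalIntegral.integral_nonneg ht fun τ _ =>
      Finset.sum_nonneg fun m _ => mul_nonneg (sq_nonneg _) (sq_nonneg _)
  have h0 : ∑ m ∈ Finset.range N, X (m + 1) 0 ^ 2 ≤ ∑' n, x n ^ 2 := by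
    calc ∑ m ∈ Finset.range N, X (m + 1) 0 ^ 2 = ∑ m ∈ Finset.range N, x (m + 1) ^ 2 :=
          Finset.sum_congr rfl fun m _ => by rw [hX.1 (m + 1) (by omega)]
      _ ≤ ∑' m, x (m + 1) ^ 2 :=
          ((summable_nat_add_iff 1).2 hx2).sum_le_tsum _ fun m _ => sq_nonneg _
      _ ≤ ∑' n, x n ^ 2 := by
          rw [hx2.tsum_eq_zero_add]
          linarith [sq_nonneg (x 0)]
  nlinarith

/-- A weak solution with non-negative square-summable datum is `ℓ²`-valued (`ν ≥ 0`).
[cite: Cheskidov2008, §4 Thm. 4.2] [cite: BarbatoMorandinRomito2011, §3] -/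
theorem IsBMRWeakSolution.summable_sq (hX : IsBMRWeakSolution ν β x X) (hβ : β ≠ 0) (hν : 0 ≤ ν)
    (hx : ∀ n, 1 ≤ n → 0 ≤ x n) (hx2 : Summable fun n => x n ^ 2) {t : ℝ} (ht : 0 ≤ t) :
    Summable fun n => X n t ^ 2 := by
  have h : Summable fun m => X (m + 1) t ^ 2 :=
    summable_of_sum_range_le (fun m => sq_nonneg _) fun N => hX.sum_sq_le_tsum hβ hν hx hx2 N ht
  exact (summable_nat_add_iff 1).1 h

/-- `∑_{n≥1} Xₙ(t)² ≤ ∑ₙ xₙ²` for a weak solution with non-negative square-summable datum (`ν ≥ 0`).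
[cite: Cheskidov2008, §4 Thm. 4.2] -/
theorem IsBMRWeakSolution.tsum_sq_le (hX : IsBMRWeakSolution ν β x X) (hβ : β ≠ 0) (hν : 0 ≤ ν)
    (hx : ∀ n, 1 ≤ n → 0 ≤ x n) (hx2 : Summable fun n => x n ^ 2) {t : ℝ} (ht : 0 ≤ t) :
    ∑' m, X (m + 1) t ^ 2 ≤ ∑' n, x n ^ 2 :=
  Real.tsum_le_of_sum_range_le (fun _ => sq_nonneg _) fun N => hX.sum_sq_le_tsum hβ hν hx hx2 N ht

/-- Pointwise bound: `Xₙ(t)² ≤ ∑ xₖ²` for `n ≥ 1`, `t ≥ 0`. [cite: Cheskidov2008, §4 Thm. 4.2] -/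
theorem IsBMRWeakSolution.sq_le_tsum (hX : IsBMRWeakSolution ν β x X) (hβ : β ≠ 0) (hν : 0 ≤ ν)
    (hx : ∀ n, 1 ≤ n → 0 ≤ x n) (hx2 : Summable fun n => x n ^ 2) {n : ℕ} (hn : 1 ≤ n) {t : ℝ}
    (ht : 0 ≤ t) : X n t ^ 2 ≤ ∑' k, x k ^ 2 := by
  obtain ⟨m, rfl⟩ : ∃ m, n = m + 1 := ⟨n - 1, by omega⟩
  refine le_trans ?_ (hX.sum_sq_le_tsum hβ hν hx hx2 (m + 1) ht)
  exact Finset.single_le_sum (f := fun j => X (j + 1) t ^ 2) (fun _ _ => sq_nonneg _)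
    (Finset.mem_range.2 (Nat.lt_succ_self m))

/-- Pointwise bound: `0 ≤ Xₙ(t) ≤ (∑ xₖ²)^{1/2}` for `n ≥ 1`, `t ≥ 0`. [cite: Cheskidov2008, §4 Thm. 4.2] -/
theorem IsBMRWeakSolution.le_sqrt_tsum (hX : IsBMRWeakSolution ν β x X) (hβ : β ≠ 0) (hν : 0 ≤ ν)
    (hx : ∀ n, 1 ≤ n → 0 ≤ x n) (hx2 : Summable fun n => x n ^ 2) {n : ℕ} (hn : 1 ≤ n) {t : ℝ}
    (ht : 0 ≤ t) : X n t ≤ Real.sqrt (∑' k, x k ^ 2) :=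
  Real.le_sqrt_of_sq_le (hX.sq_le_tsum hβ hν hx hx2 hn ht)

/-- **Dissipation bound**: `2ν ∑_{n≤N} ∫₀ᵗ λₙ²Xₙ² ≤ ∑ xₙ²` for every `N` (weak solution,
non-negative square-summable datum). [cite: Cheskidov2008, §4 Thm. 4.2] [cite: BarbatoMorandinRomito2011, §3.2] -/
theorem IsBMRWeakSolution.sum_integral_dissipation_le (hX : IsBMRWeakSolution ν β x X) (hβ : β ≠ 0)
    (hx : ∀ n, 1 ≤ n → 0 ≤ x n) (hx2 : Summable fun n => x n ^ 2) (N : ℕ) {t : ℝ} (ht : 0 ≤ t) :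
    2 * ν * ∑ m ∈ Finset.range N, ∫ τ in (0 : ℝ)..t, bmrLambda (m + 1) ^ 2 * X (m + 1) τ ^ 2 ≤
      ∑' n, x n ^ 2 := by
  have h := hX.energy_le hβ hx N le_rfl ht
  have hint : ∀ m ∈ Finset.range N, IntervalIntegrable
      (fun τ => bmrLambda (m + 1) ^ 2 * X (m + 1) τ ^ 2) volume 0 t := fun m _ =>
    ((continuousOn_const.mul ((hX.continuousOn (by omega)).pow 2)).mono Icc_subset_Ici_self
      ).intervalIntegrable_of_Icc ht
  rw [← intervalIntegral.integral_finsetSum hint]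
  have h0 : ∑ m ∈ Finset.range N, X (m + 1) 0 ^ 2 ≤ ∑' n, x n ^ 2 := by
    calc ∑ m ∈ Finset.range N, X (m + 1) 0 ^ 2 = ∑ m ∈ Finset.range N, x (m + 1) ^ 2 :=
          Finset.sum_congr rfl fun m _ => by rw [hX.1 (m + 1) (by omega)]
      _ ≤ ∑' m, x (m + 1) ^ 2 :=
          ((summable_nat_add_iff 1).2 hx2).sum_le_tsum _ fun m _ => sq_nonneg _
      _ ≤ ∑' n, x n ^ 2 := by
          rw [hx2.tsum_eq_zero_add]
          linarith [sq_nonneg (x 0)]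
  have hE : 0 ≤ ∑ m ∈ Finset.range N, X (m + 1) t ^ 2 := Finset.sum_nonneg fun m _ => sq_nonneg _
  linarith

/-- **Summability of the dissipation** ("by the energy inequality,
`∑ₙ ∫₀ᵗ (λₙXₙ(s))² ds < ∞`"): for `ν > 0` and a weak solution with non-negative square-summable
datum, `m ↦ ∫₀ᵗ λ_{m+1}²X_{m+1}²` is summable with sum `≤ ∑xₙ²/(2ν)`. [cite: BarbatoMorandinRomito2011, §3.2] -/
theorem IsBMRWeakSolution.summable_integral_dissipation (hX : IsBMRWeakSolution ν β x X)
    (hβ : β ≠ 0) (hν : 0 < ν) (hx : ∀ n, 1 ≤ n → 0 ≤ x n) (hx2 : Summable fun n => x n ^ 2)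
    {t : ℝ} (ht : 0 ≤ t) :
    Summable fun m => ∫ τ in (0 : ℝ)..t, bmrLambda (m + 1) ^ 2 * X (m + 1) τ ^ 2 := by
  refine summable_of_sum_range_le (c := (∑' n, x n ^ 2) / (2 * ν)) (fun _ => ?_) fun N => ?_
  · exact intervalIntegral.integral_nonneg ht fun τ _ => mul_nonneg (sq_nonneg _) (sq_nonneg _)
  · rw [le_div_iff₀ (by positivity), mul_comm]
    exact hX.sum_integral_dissipation_le hβ hx hx2 N ht

/-- **The dissipation of high modes is small**: `∫₀ᵗ λ_{m+1}²X_{m+1}(s)² ds → 0` as `m → ∞`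
(`ν > 0`, weak solution with non-negative square-summable datum) — the fact that closes BMR's
uniqueness argument ("the right hand side … converges to `0` as `N → ∞`"). [cite: BarbatoMorandinRomito2011, §3 Prop. 3.2 (proof)] -/
theorem IsBMRWeakSolution.tendsto_integral_dissipation (hX : IsBMRWeakSolution ν β x X)
    (hβ : β ≠ 0) (hν : 0 < ν) (hx : ∀ n, 1 ≤ n → 0 ≤ x n) (hx2 : Summable fun n => x n ^ 2)
    {t : ℝ} (ht : 0 ≤ t) :
    Tendsto (fun m => ∫ τ in (0 : ℝ)..t, bmrLambda (m + 1) ^ 2 * X (m + 1) τ ^ 2) atTop (𝓝 0) :=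
  (hX.summable_integral_dissipation hβ hν hx hx2 ht).tendsto_atTop_zero

end Energy

end Literature.Barriers.NavierStokesRegularity.Dyadic
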